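import Mathlib

/-!
# `HyperellipticRiemannRelation` (stmt-KontsevichZagierPeriods-3522), line `SketchIdeator2`:
# auxiliary one-factor bounds for the stub `stub_bounds`

Elementary real inequalities behind the kernel bounds of the line (file
`UnfoldedStokesHyperellipticRiemannRelationStubBounds.lean`).  With `Φ(z) = ∏ⱼ √(z − eⱼ)`
(principal roots), `‖√w‖ = ‖w‖^{1/2}` gives `‖Φ(z)‖⁻¹ = ∏ⱼ dⱼ^{-1/2}`, `dⱼ = |z − eⱼ|`,
`dⱼ² = (x−eⱼ)² + s²` for `z = x + is`.

* ONE-FACTOR BOUNDS (`M ≥ |eⱼ|`, `A = 1+(M+1)²`, `t = |x−eⱼ| > 0`):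
  `d^{-1/2} ≤ A (1+(d+M)²)^{-1/4} (1+t^{-3/4})` (`Bounds.half_factor`) and, for `s > 0`,
  `d^{-3/2} ≤ A (1+(d+M)²)^{-3/4} (1+s^{-3/4})(1+t^{-3/4})` (`Bounds.threeHalf_factor`): far
  (`d ≥ 1`) `1+(d+M)² ≤ A d²`; near (`d < 1`) `d^{-1/2} ≤ t^{-1/2} ≤ t^{-3/4}` and the `L¹` corner
  `d^{-3/2} = (d²)^{-3/4} ≤ (ts)^{-3/4}`.
* `Bounds.prod_weight_le`: at most one branch point is `δ`-close to `x` (`2δ ≤ min gap`,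
  `Bounds.exists_sep`), so `∏ⱼ (1+|x−eⱼ|^{-3/4}) ≤ (1+δ^{-3/4})⁴ (1 + Σₖ |x−eₖ|^{-3/4})`.
* `stub_boundsAux` (registered auxiliary stub) — the two MASTER BOUNDS
  `‖Φ(z)⁻¹‖ ≤ A⁵ D S (1+|z|²)^{-5/4}` and `‖Φ(z)⁻¹‖ Σⱼ|z−eⱼ|⁻¹ ≤ 5A⁵DS (1+s^{-3/4})(1+|z|²)^{-7/4}`
  (`D = (1+δ^{-3/4})⁴`, `S = 1 + Σₖ|x−eₖ|^{-3/4}`), since `|z| ≤ dⱼ + M` lets every factor carry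
  the common decay `(1+|z|²)^{-1/4}` (resp. `^{-3/4}`).
* `Bounds.decay_split`: `(1+|z|²)^{p+q} ≤ (1+x²)^{p}(1+s²)^{q}` for `p, q ≤ 0`.

No definitions are introduced.  Mathlib only.  [folklore]
-/

noncomputable section

namespace Summit.KontsevichZagierPeriods.UnfoldedStokes.HyperellipticRiemannRelationLine

open Set MeasureTheory Filter Topology

namespace Bounds

/-! ## One-factor inequalities (real variables) -/

/-- Far from the branch point (`d ≥ 1`): with `A = 1 + (M+1)²` and `0 < p ≤ 1`,
`d^{-2p} ≤ A (1+(d+M)²)^{-p}`. [folklore] -/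
theorem far_factor {M d p A : ℝ} (hA : A = 1 + (M + 1) ^ 2) (hM : 0 ≤ M) (hd : 1 ≤ d)
    (hp : 0 < p) (hp1 : p ≤ 1) :
    d ^ (-(2 * p)) ≤ A * (1 + (d + M) ^ 2) ^ (-p) := by
  have hA1 : 1 ≤ A := by rw [hA]; nlinarith [sq_nonneg (M + 1)]
  have hA0 : 0 < A := by linarith
  have hd0 : 0 < d := by linarith
  have hkey : 1 + (d + M) ^ 2 ≤ A * d ^ 2 := by
    rw [hA]
    nlinarith [mul_nonneg (mul_nonneg hM hM) (by nlinarith : (0:ℝ) ≤ d ^ 2 - 1),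
      mul_nonneg (mul_nonneg hM hd0.le) (by linarith : (0:ℝ) ≤ d - 1),
      (by nlinarith : (0:ℝ) ≤ d ^ 2 - 1)]
  have h1 : (A * d ^ 2) ^ (-p) ≤ (1 + (d + M) ^ 2) ^ (-p) :=
    Real.rpow_le_rpow_of_nonpos (by positivity) hkey (by linarith)
  have h2 : (A * d ^ 2) ^ (-p) = A ^ (-p) * d ^ (-(2 * p)) := by
    rw [Real.mul_rpow hA0.le (by positivity)]
    congr 1
    rw [← Real.rpow_natCast d 2, ← Real.rpow_mul hd0.le]
    congr 1
    push_cast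
    ring
  have h3 : A ^ p ≤ A := by
    conv_rhs => rw [← Real.rpow_one A]
    exact Real.rpow_le_rpow_of_exponent_le hA1 hp1
  have h4 : A ^ p * A ^ (-p) = 1 := by
    rw [Real.rpow_neg hA0.le, mul_inv_cancel₀ (Real.rpow_pos_of_pos hA0 p).ne']
  calc d ^ (-(2 * p)) = A ^ p * (A * d ^ 2) ^ (-p) := by
        rw [h2, ← mul_assoc, h4, one_mul]
    _ ≤ A ^ p * (1 + (d + M) ^ 2) ^ (-p) :=
        mul_le_mul_of_nonneg_left h1 (Real.rpow_nonneg hA0.le p)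
    _ ≤ A * (1 + (d + M) ^ 2) ^ (-p) :=
        mul_le_mul_of_nonneg_right h3 (Real.rpow_nonneg (by positivity) _)

/-- Near the branch point (`d ≤ 1`): `1 ≤ A (1+(d+M)²)^{-p}` for `0 < p ≤ 1`. [folklore] -/
theorem near_factor {M d p A : ℝ} (hA : A = 1 + (M + 1) ^ 2) (hM : 0 ≤ M) (hd0 : 0 ≤ d)
    (hd : d ≤ 1) (hp : 0 < p) (hp1 : p ≤ 1) :
    1 ≤ A * (1 + (d + M) ^ 2) ^ (-p) := by
  have hA1 : 1 ≤ A := by rw [hA]; nlinarith [sq_nonneg (M + 1)]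
  have hA0 : 0 < A := by linarith
  have hkey : 1 + (d + M) ^ 2 ≤ A := by rw [hA]; nlinarith
  have h1 : A ^ (-p) ≤ (1 + (d + M) ^ 2) ^ (-p) :=
    Real.rpow_le_rpow_of_nonpos (by positivity) hkey (by linarith)
  have h2 : 1 ≤ A * A ^ (-p) := by
    rw [Real.rpow_neg hA0.le, ← div_eq_mul_inv, one_le_div (Real.rpow_pos_of_pos hA0 p)]
    conv_rhs => rw [← Real.rpow_one A]
    exact Real.rpow_le_rpow_of_exponent_le hA1 hp1
  exact h2.trans (mul_le_mul_of_nonneg_left h1 hA0.le)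

/-- One square-root factor: for `0 < t ≤ d` (`t = |x−a|`, `d = |z−a|`),
`d^{-1/2} ≤ A (1+(d+M)²)^{-1/4} (1 + t^{-3/4})`. [folklore] -/
theorem half_factor {M d t A : ℝ} (hA : A = 1 + (M + 1) ^ 2) (hM : 0 ≤ M) (ht : 0 < t)
    (htd : t ≤ d) :
    d ^ (-(1 / 2 : ℝ)) ≤ A * (1 + (d + M) ^ 2) ^ (-(1 / 4 : ℝ)) * (1 + t ^ (-(3:ℝ) / 4)) := by
  have hd0 : 0 < d := ht.trans_le htd
  have ht34 : 0 ≤ t ^ (-(3:ℝ) / 4) := Real.rpow_nonneg ht.le _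
  rcases le_or_gt 1 d with hd1 | hd1
  · have h := far_factor hA hM hd1 (by norm_num : (0:ℝ) < 1 / 4) (by norm_num)
    have h' : d ^ (-(1 / 2 : ℝ)) ≤ A * (1 + (d + M) ^ 2) ^ (-(1 / 4 : ℝ)) := by
      convert h using 2; norm_num
    have hpos : 0 ≤ A * (1 + (d + M) ^ 2) ^ (-(1 / 4 : ℝ)) :=
      le_trans (Real.rpow_nonneg hd0.le _) h'
    calc d ^ (-(1 / 2 : ℝ)) ≤ A * (1 + (d + M) ^ 2) ^ (-(1 / 4 : ℝ)) * 1 := by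
          rw [mul_one]; exact h'
      _ ≤ _ := mul_le_mul_of_nonneg_left (by linarith) hpos
  · have h := near_factor hA hM hd0.le hd1.le (by norm_num : (0:ℝ) < 1 / 4) (by norm_num)
    have h1 : d ^ (-(1 / 2 : ℝ)) ≤ t ^ (-(1 / 2 : ℝ)) :=
      Real.rpow_le_rpow_of_nonpos ht htd (by norm_num)
    have h2 : t ^ (-(1 / 2 : ℝ)) ≤ t ^ (-(3:ℝ) / 4) :=
      Real.rpow_le_rpow_of_exponent_ge ht (by linarith) (by norm_num)
    calc d ^ (-(1 / 2 : ℝ)) ≤ 1 * (1 + t ^ (-(3:ℝ) / 4)) := by linarith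
      _ ≤ _ := mul_le_mul_of_nonneg_right h (by positivity)

/-- One factor carrying the extra pole (the `L¹` corner): for `0 < t ≤ d`, `0 < s`, `ts ≤ d²`,
`d^{-3/2} ≤ A (1+(d+M)²)^{-3/4} (1 + s^{-3/4}) (1 + t^{-3/4})`. [folklore] -/
theorem threeHalf_factor {M d t s A : ℝ} (hA : A = 1 + (M + 1) ^ 2) (hM : 0 ≤ M) (ht : 0 < t)
    (hs : 0 < s) (htd : t ≤ d) (hts : t * s ≤ d ^ 2) :
    d ^ (-(3 / 2 : ℝ)) ≤ A * (1 + (d + M) ^ 2) ^ (-(3 / 4 : ℝ)) *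
      ((1 + s ^ (-(3:ℝ) / 4)) * (1 + t ^ (-(3:ℝ) / 4))) := by
  have hd0 : 0 < d := ht.trans_le htd
  have ht34 : 0 ≤ t ^ (-(3:ℝ) / 4) := Real.rpow_nonneg ht.le _
  have hs34 : 0 ≤ s ^ (-(3:ℝ) / 4) := Real.rpow_nonneg hs.le _
  have hone : 1 ≤ (1 + s ^ (-(3:ℝ) / 4)) * (1 + t ^ (-(3:ℝ) / 4)) := by nlinarith
  rcases le_or_gt 1 d with hd1 | hd1
  · have h := far_factor hA hM hd1 (by norm_num : (0:ℝ) < 3 / 4) (by norm_num)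
    have h' : d ^ (-(3 / 2 : ℝ)) ≤ A * (1 + (d + M) ^ 2) ^ (-(3 / 4 : ℝ)) := by
      convert h using 2; norm_num
    have hpos : 0 ≤ A * (1 + (d + M) ^ 2) ^ (-(3 / 4 : ℝ)) :=
      le_trans (Real.rpow_nonneg hd0.le _) h'
    calc d ^ (-(3 / 2 : ℝ)) ≤ A * (1 + (d + M) ^ 2) ^ (-(3 / 4 : ℝ)) * 1 := by
          rw [mul_one]; exact h'
      _ ≤ _ := mul_le_mul_of_nonneg_left hone hpos
  · have h := near_factor hA hM hd0.le hd1.le (by norm_num : (0:ℝ) < 3 / 4) (by norm_num)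
    have h1 : d ^ (-(3 / 2 : ℝ)) = (d ^ 2) ^ (-(3:ℝ) / 4) := by
      rw [← Real.rpow_natCast d 2, ← Real.rpow_mul hd0.le]; norm_num
    have h2 : (d ^ 2) ^ (-(3:ℝ) / 4) ≤ (t * s) ^ (-(3:ℝ) / 4) :=
      Real.rpow_le_rpow_of_nonpos (by positivity) hts (by norm_num)
    have h3 : (t * s) ^ (-(3:ℝ) / 4) = t ^ (-(3:ℝ) / 4) * s ^ (-(3:ℝ) / 4) :=
      Real.mul_rpow ht.le hs.le
    have h4 : t ^ (-(3:ℝ) / 4) * s ^ (-(3:ℝ) / 4) ≤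
        (1 + s ^ (-(3:ℝ) / 4)) * (1 + t ^ (-(3:ℝ) / 4)) := by nlinarith
    calc d ^ (-(3 / 2 : ℝ)) ≤ 1 * ((1 + s ^ (-(3:ℝ) / 4)) * (1 + t ^ (-(3:ℝ) / 4))) := by
          rw [one_mul, h1]; exact h2.trans (h3.le.trans h4)
      _ ≤ _ := mul_le_mul_of_nonneg_right h (by positivity)

/-! ## The five `x`-weights and the separation of the branch points -/

/-- At most one branch point is `δ`-close to `x`, hence
`∏ⱼ (1 + |x−eⱼ|^{-3/4}) ≤ (1 + δ^{-3/4})⁴ (1 + Σₖ |x−eₖ|^{-3/4})`. [folklore] -/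
theorem prod_weight_le {e : Fin 5 → ℝ} {δ : ℝ} (hδ : 0 < δ)
    (hsep : ∀ i j, i ≠ j → 2 * δ ≤ |e i - e j|) (x : ℝ) :
    ∏ j, (1 + |x - e j| ^ (-(3:ℝ) / 4)) ≤
      (1 + δ ^ (-(3:ℝ) / 4)) ^ 4 * (1 + ∑ k, |x - e k| ^ (-(3:ℝ) / 4)) := by
  obtain ⟨k, hk⟩ := Finite.exists_min (fun j => |x - e j|)
  have hfar : ∀ j, j ≠ k → δ ≤ |x - e j| := by
    intro j hj
    have h1 := hsep j k hj
    have h2 : |e j - e k| ≤ |e j - x| + |x - e k| := abs_sub_le _ _ _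
    have h3 : |x - e k| ≤ |x - e j| := hk j
    rw [abs_sub_comm (e j) x] at h2
    linarith
  have hnn : ∀ j, 0 ≤ |x - e j| ^ (-(3:ℝ) / 4) := fun j => Real.rpow_nonneg (abs_nonneg _) _
  rw [← Finset.mul_prod_erase Finset.univ (fun j => 1 + |x - e j| ^ (-(3:ℝ) / 4))
    (Finset.mem_univ k)]
  have hk_le : 1 + |x - e k| ^ (-(3:ℝ) / 4) ≤ 1 + ∑ k, |x - e k| ^ (-(3:ℝ) / 4) := by
    have := Finset.single_le_sum (f := fun j => |x - e j| ^ (-(3:ℝ) / 4)) (fun j _ => hnn j)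
      (Finset.mem_univ k)
    linarith
  have hrest : ∏ j ∈ Finset.univ.erase k, (1 + |x - e j| ^ (-(3:ℝ) / 4)) ≤
      (1 + δ ^ (-(3:ℝ) / 4)) ^ 4 := by
    calc ∏ j ∈ Finset.univ.erase k, (1 + |x - e j| ^ (-(3:ℝ) / 4))
        ≤ ∏ j ∈ Finset.univ.erase k, (1 + δ ^ (-(3:ℝ) / 4)) := by
          apply Finset.prod_le_prod (fun j _ => by positivity)
          intro j hj
          have hjk : j ≠ k := Finset.ne_of_mem_erase hj
          have := Real.rpow_le_rpow_of_nonpos hδ (hfar j hjk) (by norm_num : (-(3:ℝ) / 4) ≤ 0)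
          linarith
      _ = (1 + δ ^ (-(3:ℝ) / 4)) ^ 4 := by
          rw [Finset.prod_const, Finset.card_erase_of_mem (Finset.mem_univ k), Finset.card_univ,
            Fintype.card_fin]
  calc (1 + |x - e k| ^ (-(3:ℝ) / 4)) * ∏ j ∈ Finset.univ.erase k, (1 + |x - e j| ^ (-(3:ℝ) / 4))
      ≤ (1 + ∑ k, |x - e k| ^ (-(3:ℝ) / 4)) * (1 + δ ^ (-(3:ℝ) / 4)) ^ 4 :=
        mul_le_mul hk_le hrest (Finset.prod_nonneg fun j _ => by positivity) (by positivity)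
    _ = _ := mul_comm _ _

/-- Strictly increasing branch points are uniformly separated: `2δ ≤ |eᵢ − eⱼ|` for `i ≠ j`.
[folklore] -/
theorem exists_sep {e : Fin 5 → ℚ} (he : StrictMono e) :
    ∃ δ : ℝ, 0 < δ ∧ ∀ i j, i ≠ j → 2 * δ ≤ |((e i : ℚ) : ℝ) - ((e j : ℚ) : ℝ)| := by
  haveI : Nonempty {p : Fin 5 × Fin 5 // p.1 ≠ p.2} := ⟨⟨(0, 1), by decide⟩⟩
  obtain ⟨p₀, hp₀⟩ := Finite.exists_min
    (fun p : {p : Fin 5 × Fin 5 // p.1 ≠ p.2} => |((e p.1.1 : ℚ) : ℝ) - ((e p.1.2 : ℚ) : ℝ)|)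
  have hpos : 0 < |((e p₀.1.1 : ℚ) : ℝ) - ((e p₀.1.2 : ℚ) : ℝ)| := by
    rw [abs_pos, sub_ne_zero]
    exact_mod_cast he.injective.ne p₀.2
  refine ⟨|((e p₀.1.1 : ℚ) : ℝ) - ((e p₀.1.2 : ℚ) : ℝ)| / 2, by positivity, fun i j hij => ?_⟩
  have := hp₀ ⟨(i, j), hij⟩
  simp only at this
  linarith

/-! ## Norms -/

/-- `‖√w‖ = ‖w‖^{1/2}` for the principal square root. [folklore] -/
theorem norm_sqrt (w : ℂ) : ‖Complex.sqrt w‖ = ‖w‖ ^ (1 / 2 : ℝ) := by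
  rw [Complex.sqrt, ← Complex.norm_cpow_real]; norm_num

/-- `‖(∏ⱼ √(z − cⱼ))⁻¹‖ = ∏ⱼ ‖z − cⱼ‖^{-1/2}`. [folklore] -/
theorem norm_inv_prod_sqrt (c : Fin 5 → ℂ) (z : ℂ) :
    ‖(∏ j, Complex.sqrt (z - c j))⁻¹‖ = ∏ j, ‖z - c j‖ ^ (-(1 / 2 : ℝ)) := by
  rw [norm_inv, norm_prod, ← Finset.prod_inv_distrib]
  refine Finset.prod_congr rfl fun j _ => ?_
  rw [Real.rpow_neg (norm_nonneg _), norm_sqrt]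

/-- Splitting the decay: `(1+|z|²)^{p+q} ≤ (1+x²)^p (1+s²)^q` for `p, q ≤ 0`, `x², s² ≤ |z|²`.
[folklore] -/
theorem decay_split {x s Z p q r : ℝ} (hx : x ^ 2 ≤ Z ^ 2) (hs : s ^ 2 ≤ Z ^ 2) (hp : p ≤ 0)
    (hq : q ≤ 0) (hr : r = p + q) :
    (1 + Z ^ 2) ^ r ≤ (1 + x ^ 2) ^ p * (1 + s ^ 2) ^ q := by
  rw [hr, Real.rpow_add (by positivity)]
  exact mul_le_mul (Real.rpow_le_rpow_of_nonpos (by positivity) (by linarith) hp)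
    (Real.rpow_le_rpow_of_nonpos (by positivity) (by linarith) hq)
    (Real.rpow_nonneg (by positivity) _) (Real.rpow_nonneg (by positivity) _)


end Bounds

/-! ## Registered auxiliary stub: the two master bounds on the closed upper half-plane -/

open Bounds in
/-- **Master bounds.** With `|eⱼ| ≤ M`, `A = 1+(M+1)²`, `2δ ≤ |eᵢ − eⱼ|` (`i ≠ j`),
`D = (1+δ^{-3/4})⁴`, `S = 1 + Σₖ |x−eₖ|^{-3/4}`, `z = x + is` (`s ≥ 0`, `x` off the branch points):
`‖(∏ⱼ √(z−eⱼ))⁻¹‖ ≤ A⁵ D S (1+|z|²)^{-5/4}` and, for `s > 0`,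
`‖(∏ⱼ √(z−eⱼ))⁻¹‖ Σⱼ |z−eⱼ|⁻¹ ≤ 5 A⁵ D S (1+s^{-3/4}) (1+|z|²)^{-7/4}`. [folklore] -/
theorem stub_boundsAux :
    ∀ (e : Fin 5 → ℚ) (M δ A D S x s : ℝ) (z : ℂ), (∀ j, |(e j : ℝ)| ≤ M) → 0 ≤ M →
      A = 1 + (M + 1) ^ 2 → 0 < δ → (∀ i j, i ≠ j → 2 * δ ≤ |((e i : ℚ) : ℝ) - ((e j : ℚ) : ℝ)|) →
      D = (1 + δ ^ (-(3:ℝ) / 4)) ^ 4 → S = 1 + ∑ k, |x - (e k : ℝ)| ^ (-(3:ℝ) / 4) → 0 ≤ s →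
      (∀ j, x ≠ (e j : ℝ)) → z = (x : ℂ) + (s : ℂ) * Complex.I →
      ‖(∏ j, Complex.sqrt (z - ((e j : ℝ) : ℂ)))⁻¹‖ ≤
          A ^ 5 * D * S * (1 + ‖z‖ ^ 2) ^ (-(5 / 4 : ℝ)) ∧
        (0 < s → ‖(∏ j, Complex.sqrt (z - ((e j : ℝ) : ℂ)))⁻¹‖ * ∑ j, ‖z - ((e j : ℝ) : ℂ)‖⁻¹ ≤
          5 * A ^ 5 * D * S * (1 + s ^ (-(3:ℝ) / 4)) * (1 + ‖z‖ ^ 2) ^ (-(7 / 4 : ℝ))) := by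
  intro e M δ A D S x s z hMj hM0 hA hδ hsep hD hS hs hx hz
  -- geometry of each factor `z - eⱼ`
  have hre : ∀ j, (z - ((e j : ℝ) : ℂ)).re = x - (e j : ℝ) := fun j => by subst hz; simp
  have him : ∀ j, (z - ((e j : ℝ) : ℂ)).im = s := fun j => by subst hz; simp
  have ht0 : ∀ j, 0 < |x - (e j : ℝ)| := fun j => abs_pos.2 (sub_ne_zero.2 (hx j))
  have htd : ∀ j, |x - (e j : ℝ)| ≤ ‖z - ((e j : ℝ) : ℂ)‖ := fun j => by
    have h := Complex.abs_re_le_norm (z - ((e j : ℝ) : ℂ))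
    rwa [hre j] at h
  have hd0 : ∀ j, 0 < ‖z - ((e j : ℝ) : ℂ)‖ := fun j => (ht0 j).trans_le (htd j)
  have hd2 : ∀ j, ‖z - ((e j : ℝ) : ℂ)‖ ^ 2 = |x - (e j : ℝ)| ^ 2 + s ^ 2 := fun j => by
    rw [Complex.sq_norm, Complex.normSq_apply, hre j, him j, sq_abs]; ring
  have hts : ∀ j, |x - (e j : ℝ)| * s ≤ ‖z - ((e j : ℝ) : ℂ)‖ ^ 2 := fun j => by
    rw [hd2 j]; nlinarith [sq_nonneg (|x - (e j : ℝ)| - s)]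
  have hZd : ∀ j, ‖z‖ ≤ ‖z - ((e j : ℝ) : ℂ)‖ + M := fun j => by
    calc ‖z‖ = ‖(z - ((e j : ℝ) : ℂ)) + ((e j : ℝ) : ℂ)‖ := by rw [sub_add_cancel]
      _ ≤ ‖z - ((e j : ℝ) : ℂ)‖ + ‖((e j : ℝ) : ℂ)‖ := norm_add_le _ _
      _ ≤ _ := by
          rw [Complex.norm_real, Real.norm_eq_abs]
          linarith [hMj j]
  have hω0 : 0 < 1 + ‖z‖ ^ 2 := by positivity
  -- every factor carries the common decay `(1+|z|²)^{-p}`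
  have hω : ∀ j (p : ℝ), 0 ≤ p →
      (1 + (‖z - ((e j : ℝ) : ℂ)‖ + M) ^ 2) ^ (-p) ≤ (1 + ‖z‖ ^ 2) ^ (-p) := fun j p hp => by
    apply Real.rpow_le_rpow_of_nonpos hω0 _ (by linarith)
    nlinarith [hZd j, norm_nonneg z]
  have hA0 : 0 ≤ A := by rw [hA]; positivity
  -- per-factor bounds
  have pf1 : ∀ j, ‖z - ((e j : ℝ) : ℂ)‖ ^ (-(1 / 2 : ℝ)) ≤
      A * (1 + ‖z‖ ^ 2) ^ (-(1 / 4 : ℝ)) * (1 + |x - (e j : ℝ)| ^ (-(3:ℝ) / 4)) := fun j => by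
    have h := half_factor hA hM0 (ht0 j) (htd j)
    have h' := hω j (1 / 4) (by norm_num)
    have hw : 0 ≤ 1 + |x - (e j : ℝ)| ^ (-(3:ℝ) / 4) := by positivity
    exact h.trans (mul_le_mul_of_nonneg_right (mul_le_mul_of_nonneg_left h' hA0) hw)
  have pf3 : 0 < s → ∀ j, ‖z - ((e j : ℝ) : ℂ)‖ ^ (-(3 / 2 : ℝ)) ≤
      A * (1 + ‖z‖ ^ 2) ^ (-(3 / 4 : ℝ)) *
        ((1 + s ^ (-(3:ℝ) / 4)) * (1 + |x - (e j : ℝ)| ^ (-(3:ℝ) / 4))) := fun hs0 j => by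
    have h := threeHalf_factor hA hM0 (ht0 j) hs0 (htd j) (hts j)
    have h' := hω j (3 / 4) (by norm_num)
    have hw : 0 ≤ (1 + s ^ (-(3:ℝ) / 4)) * (1 + |x - (e j : ℝ)| ^ (-(3:ℝ) / 4)) := by
      have := Real.rpow_nonneg hs (-(3:ℝ) / 4)
      positivity
    exact h.trans (mul_le_mul_of_nonneg_right (mul_le_mul_of_nonneg_left h' hA0) hw)
  -- the product of the five `x`-weights
  have hW : ∏ j, (1 + |x - (e j : ℝ)| ^ (-(3:ℝ) / 4)) ≤ D * S := by
    have := prod_weight_le (e := fun j => (e j : ℝ)) hδ hsep x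
    rw [hD, hS]
    simpa using this
  have hDS : 0 ≤ D * S := le_trans (Finset.prod_nonneg fun j _ => by positivity) hW
  have hnorm := norm_inv_prod_sqrt (fun j => ((e j : ℝ) : ℂ)) z
  -- exponent bookkeeping
  have hω5 : ((1 + ‖z‖ ^ 2) ^ (-(1 / 4 : ℝ))) ^ 5 = (1 + ‖z‖ ^ 2) ^ (-(5 / 4 : ℝ)) := by
    rw [← Real.rpow_natCast _ 5, ← Real.rpow_mul hω0.le]; norm_num
  have hω7 : (1 + ‖z‖ ^ 2) ^ (-(3 / 4 : ℝ)) * ((1 + ‖z‖ ^ 2) ^ (-(1 / 4 : ℝ))) ^ 4 =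
      (1 + ‖z‖ ^ 2) ^ (-(7 / 4 : ℝ)) := by
    rw [← Real.rpow_natCast _ 4, ← Real.rpow_mul hω0.le, ← Real.rpow_add hω0]; norm_num
  -- master bound 0
  have hprod : ∏ j, ‖z - ((e j : ℝ) : ℂ)‖ ^ (-(1 / 2 : ℝ)) ≤
      A ^ 5 * D * S * (1 + ‖z‖ ^ 2) ^ (-(5 / 4 : ℝ)) := by
    calc ∏ j, ‖z - ((e j : ℝ) : ℂ)‖ ^ (-(1 / 2 : ℝ))
        ≤ ∏ j, (A * (1 + ‖z‖ ^ 2) ^ (-(1 / 4 : ℝ)) * (1 + |x - (e j : ℝ)| ^ (-(3:ℝ) / 4))) :=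
          Finset.prod_le_prod (fun j _ => by positivity) (fun j _ => pf1 j)
      _ = (A * (1 + ‖z‖ ^ 2) ^ (-(1 / 4 : ℝ))) ^ 5 *
            ∏ j, (1 + |x - (e j : ℝ)| ^ (-(3:ℝ) / 4)) := by
          rw [Finset.prod_mul_distrib, Finset.prod_const, Finset.card_univ, Fintype.card_fin]
      _ ≤ (A * (1 + ‖z‖ ^ 2) ^ (-(1 / 4 : ℝ))) ^ 5 * (D * S) :=
          mul_le_mul_of_nonneg_left hW (by positivity)
      _ = A ^ 5 * D * S * (1 + ‖z‖ ^ 2) ^ (-(5 / 4 : ℝ)) := by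
          rw [mul_pow, hω5]; ring
  refine ⟨hnorm ▸ hprod, fun hs0 => ?_⟩
  -- master bound 1
  rw [hnorm, Finset.mul_sum]
  have hterm : ∀ j, (∏ i, ‖z - ((e i : ℝ) : ℂ)‖ ^ (-(1 / 2 : ℝ))) * ‖z - ((e j : ℝ) : ℂ)‖⁻¹ ≤
      A ^ 5 * D * S * (1 + s ^ (-(3:ℝ) / 4)) * (1 + ‖z‖ ^ 2) ^ (-(7 / 4 : ℝ)) := fun j => by
    rw [← Finset.mul_prod_erase Finset.univ (fun i => ‖z - ((e i : ℝ) : ℂ)‖ ^ (-(1 / 2 : ℝ)))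
      (Finset.mem_univ j)]
    have h32 : ‖z - ((e j : ℝ) : ℂ)‖ ^ (-(1 / 2 : ℝ)) * ‖z - ((e j : ℝ) : ℂ)‖⁻¹ =
        ‖z - ((e j : ℝ) : ℂ)‖ ^ (-(3 / 2 : ℝ)) := by
      rw [← Real.rpow_neg_one, ← Real.rpow_add (hd0 j)]; norm_num
    have herase : ∏ i ∈ Finset.univ.erase j, ‖z - ((e i : ℝ) : ℂ)‖ ^ (-(1 / 2 : ℝ)) ≤
        (A * (1 + ‖z‖ ^ 2) ^ (-(1 / 4 : ℝ))) ^ 4 *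
          ∏ i ∈ Finset.univ.erase j, (1 + |x - (e i : ℝ)| ^ (-(3:ℝ) / 4)) := by
      calc ∏ i ∈ Finset.univ.erase j, ‖z - ((e i : ℝ) : ℂ)‖ ^ (-(1 / 2 : ℝ))
          ≤ ∏ i ∈ Finset.univ.erase j,
              (A * (1 + ‖z‖ ^ 2) ^ (-(1 / 4 : ℝ)) * (1 + |x - (e i : ℝ)| ^ (-(3:ℝ) / 4))) :=
            Finset.prod_le_prod (fun i _ => by positivity) (fun i _ => pf1 i)
        _ = _ := by
            rw [Finset.prod_mul_distrib, Finset.prod_const,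
              Finset.card_erase_of_mem (Finset.mem_univ j), Finset.card_univ, Fintype.card_fin]
    have hWj : (1 + |x - (e j : ℝ)| ^ (-(3:ℝ) / 4)) *
        ∏ i ∈ Finset.univ.erase j, (1 + |x - (e i : ℝ)| ^ (-(3:ℝ) / 4)) ≤ D * S := by
      rw [Finset.mul_prod_erase Finset.univ (fun i => 1 + |x - (e i : ℝ)| ^ (-(3:ℝ) / 4))
        (Finset.mem_univ j)]
      exact hW
    have hs34 : 0 ≤ s ^ (-(3:ℝ) / 4) := Real.rpow_nonneg hs _
    calc ‖z - ((e j : ℝ) : ℂ)‖ ^ (-(1 / 2 : ℝ)) *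
          (∏ i ∈ Finset.univ.erase j, ‖z - ((e i : ℝ) : ℂ)‖ ^ (-(1 / 2 : ℝ))) *
            ‖z - ((e j : ℝ) : ℂ)‖⁻¹
        = ‖z - ((e j : ℝ) : ℂ)‖ ^ (-(3 / 2 : ℝ)) *
            ∏ i ∈ Finset.univ.erase j, ‖z - ((e i : ℝ) : ℂ)‖ ^ (-(1 / 2 : ℝ)) := by
          rw [mul_right_comm, h32]
      _ ≤ (A * (1 + ‖z‖ ^ 2) ^ (-(3 / 4 : ℝ)) *
              ((1 + s ^ (-(3:ℝ) / 4)) * (1 + |x - (e j : ℝ)| ^ (-(3:ℝ) / 4)))) *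
            ((A * (1 + ‖z‖ ^ 2) ^ (-(1 / 4 : ℝ))) ^ 4 *
              ∏ i ∈ Finset.univ.erase j, (1 + |x - (e i : ℝ)| ^ (-(3:ℝ) / 4))) :=
          mul_le_mul (pf3 hs0 j) herase (Finset.prod_nonneg fun i _ => by positivity)
            (by positivity)
      _ = A ^ 5 * ((1 + ‖z‖ ^ 2) ^ (-(3 / 4 : ℝ)) * ((1 + ‖z‖ ^ 2) ^ (-(1 / 4 : ℝ))) ^ 4) *
            (1 + s ^ (-(3:ℝ) / 4)) *
            ((1 + |x - (e j : ℝ)| ^ (-(3:ℝ) / 4)) *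
              ∏ i ∈ Finset.univ.erase j, (1 + |x - (e i : ℝ)| ^ (-(3:ℝ) / 4))) := by ring
      _ ≤ A ^ 5 * ((1 + ‖z‖ ^ 2) ^ (-(3 / 4 : ℝ)) * ((1 + ‖z‖ ^ 2) ^ (-(1 / 4 : ℝ))) ^ 4) *
            (1 + s ^ (-(3:ℝ) / 4)) * (D * S) :=
          mul_le_mul_of_nonneg_left hWj (by positivity)
      _ = _ := by rw [hω7]; ring
  calc ∑ j, (∏ i, ‖z - ((e i : ℝ) : ℂ)‖ ^ (-(1 / 2 : ℝ))) * ‖z - ((e j : ℝ) : ℂ)‖⁻¹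
      ≤ ∑ _j : Fin 5, A ^ 5 * D * S * (1 + s ^ (-(3:ℝ) / 4)) * (1 + ‖z‖ ^ 2) ^ (-(7 / 4 : ℝ)) :=
        Finset.sum_le_sum fun j _ => hterm j
    _ = _ := by
        rw [Finset.sum_const, Finset.card_univ, Fintype.card_fin, nsmul_eq_mul]
        push_cast
        ring

end Summit.KontsevichZagierPeriods.UnfoldedStokes.HyperellipticRiemannRelationLine
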